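import Summits.AtomisticToContinuum.Crystallization.Theorems.SquareWellLayerCakeStackingFaultSparsityOfLaminarBarlowWindows
import Summits.AtomisticToContinuum.Crystallization.Theorems.LaminarSixThreeThreeLaminarToBarlow
import Summits.AtomisticToContinuum.Crystallization.Theorems.LaminarSixThreeThreeBarlowToHcpWindows
import Summits.AtomisticToContinuum.Crystallization.Theorems.LaminarSixThreeThreeHcpWindowsToPeriodicWindows

/-!
# Route `LaminarSixThreeThree` without its rank-5 crux: `StackingFaultSparsity`, the hinge and the
route's conclusion from the three laminar cruxes alone

The deciding theorem `Theses.LaminarSixThreeThree.closes` (and the item `Assembly`, stmt-13723) consume the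
crux `StackingFaultSparsity` (stmt-AtomisticToContinuum-14296) exactly once, in
`BarlowToHcpWindows hX hS`, i.e. only TOGETHER with the target `X = LaminarBarlowWindows`, which `closes`
derives from the three laminar cruxes `LjLaminarity`, `LaminarSaturation`, `LaminarRigidity` through the
proved glue `LaminarToBarlow` (`laminarToBarlow_proof`).  The checked line `Sketch` of the crux has landed
`StackingFaultSparsity_of_laminarBarlowWindows' : LaminarBarlowWindows → StackingFaultSparsity`
(`Theorems/SquareWellLayerCakeStackingFaultSparsityOfLaminarBarlowWindows.lean`: every registered stub but the
X-type `stub_coarsening` is a theorem — certified off-box scale gap, dilute faults, far paste, covering count).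
Hence for THIS route too the crux is a consequence of the items upstream of it:

* `StackingFaultSparsity_of_laminarCruxes : LjLaminarity → LaminarSaturation → LaminarRigidity →
  StackingFaultSparsity`;
* `hcpWindows_of_laminarCruxes` — eventual hcp windows (the conclusion of `BarlowToHcpWindows`);
* `periodicWindows_of_laminarCruxes : LjLaminarity → LaminarSaturation → LaminarRigidity → PeriodicWindows`
  (the shared hinge stmt-3240) and `isCrystallizing_of_laminarCruxes` (conjunct (ii) of `Crystallization`);
* `crystallization_of_laminarCruxes : LjLaminarity → LaminarSaturation → LaminarRigidity →
  CrysPeriodicMinAttained → Crystallization` (= `closes` / `Assembly` with `StackingFaultSparsity` and every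
  proved support discharged: the route's open obligations are exactly stmt-14293, 14294, 14295 and 0627).

All `[folklore]` glue over landed theorems (`laminarToBarlow_proof`, `barlowToHcpWindows_proof`,
`hcpWindowsToPeriodicWindows_proof`, `HullCriterion_holds`, `CrysEnergyLimit_holds`); the companion file
`…StackingFaultSparsityOfGapTwelve.lean` does the same for the sibling route `SquareWellLayerCake` (K1–K3).
Planner note (D-0014): item 14296 may be restated as `LaminarBarlowWindows → <body>` (closed at once by
`StackingFaultSparsity_of_laminarBarlowWindows'`) or dropped from both routes' load-bearing lists.
-/

noncomputable section

namespace Summit.AtomisticToContinuum.Crystallization.Theorems.LaminarSixThreeThreeOfLaminarCruxes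

open Summit.AtomisticToContinuum.Crystallization.Theses.LaminarSixThreeThree
open Summit.AtomisticToContinuum.Crystallization.Theorems

/-- **The crux from the three laminar cruxes** (route `LaminarSixThreeThree`): `LjLaminarity`,
`LaminarSaturation` and `LaminarRigidity` give `X = LaminarBarlowWindows` by the proved glue
`laminarToBarlow_proof`, and `X` gives `StackingFaultSparsity` by the landed conditional closure of line
`Sketch`. [folklore] -/
theorem StackingFaultSparsity_of_laminarCruxes :
    LjLaminarity → LaminarSaturation → LaminarRigidity → StackingFaultSparsity :=
  fun hLam hSat hRig =>
    SquareWellLayerCake.StackingFaultSparsity.OfLaminarBarlowWindows.StackingFaultSparsity_of_laminarBarlowWindows'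
      (laminarToBarlow_proof hLam hSat hRig)

/-- **Eventual hcp windows from the three laminar cruxes**: the conclusion of the counting glue
`BarlowToHcpWindows` (stmt-14299, proved) with both of its hypotheses discharged from `LjLaminarity`,
`LaminarSaturation`, `LaminarRigidity`. [folklore] -/
theorem hcpWindows_of_laminarCruxes (hLam : LjLaminarity) (hSat : LaminarSaturation) (hRig : LaminarRigidity) :
    ∀ R ε : ℝ, 0 < R → 0 < ε → ε < 1 / 4 → ∀ x : (N : ℕ) → (Fin N → EuclideanSpace ℝ (Fin 3)),
      (∀ N, Literature.MathematicalPhysics.StatisticalMechanics.IsGroundState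
        Literature.MathematicalPhysics.StatisticalMechanics.lennardJones (x N)) →
      ∀ᶠ N in Filter.atTop, ∃ i : Fin N, ∃ a h : ℝ, 1 / 2 < a ∧ a < 2 ∧ 1 / 2 < h ∧ h < 2 ∧
        ∃ z ∈ Literature.MathematicalPhysics.StatisticalMechanics.hcpStacking a h,
        ∃ A : EuclideanSpace ℝ (Fin 3) →ₗᵢ[ℝ] EuclideanSpace ℝ (Fin 3),
          (∀ p ∈ Literature.MathematicalPhysics.StatisticalMechanics.hcpStacking a h, dist p z ≤ R →
            ∃ j : Fin N, dist (x N j) (x N i + A (p - z)) ≤ ε) ∧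
          (∀ j : Fin N, dist (x N j) (x N i) ≤ R →
            ∃ p ∈ Literature.MathematicalPhysics.StatisticalMechanics.hcpStacking a h,
              dist (x N j) (x N i + A (p - z)) ≤ ε) :=
  barlowToHcpWindows_proof (laminarToBarlow_proof hLam hSat hRig)
    (StackingFaultSparsity_of_laminarCruxes hLam hSat hRig)

/-- **The shared hinge `PeriodicWindows` (stmt-3240) from the three laminar cruxes**, through the proved
compactness glue `hcpWindowsToPeriodicWindows_proof` (stmt-14300). [folklore] -/
theorem periodicWindows_of_laminarCruxes :
    LjLaminarity → LaminarSaturation → LaminarRigidity → PeriodicWindows :=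
  fun hLam hSat hRig => hcpWindowsToPeriodicWindows_proof (hcpWindows_of_laminarCruxes hLam hSat hRig)

/-- **Conjunct (ii) of `Crystallization` from the three laminar cruxes**: `IsCrystallizing lennardJones 3`
by the proved hull criterion `HullCriterion_holds` (stmt-3243) applied to `periodicWindows_of_laminarCruxes`.
[folklore] -/
theorem isCrystallizing_of_laminarCruxes (hLam : LjLaminarity) (hSat : LaminarSaturation)
    (hRig : LaminarRigidity) :
    Literature.MathematicalPhysics.StatisticalMechanics.IsCrystallizing
      Literature.MathematicalPhysics.StatisticalMechanics.lennardJones 3 :=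
  HullCriterion_holds (periodicWindows_of_laminarCruxes hLam hSat hRig)

/-- **The route's conclusion without `StackingFaultSparsity`**: `LjLaminarity`, `LaminarSaturation`,
`LaminarRigidity` and `CrysPeriodicMinAttained` (stmt-0627) imply `Crystallization` — the deciding theorem
`closes` / item `Assembly` with the crux stmt-14296 and every proved support (`LaminarToBarlow`,
`BarlowToHcpWindows`, `HcpWindowsToPeriodicWindows`, `HullCriterion`, `CrysEnergyLimit`) discharged; conjunct
(i) is `CrysEnergyLimit_holds` with its limit `⨅_Q e(Q)` rewritten as `e(P)` for the least periodic `P`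
(`IsLeast.csInf_eq`), verbatim from `closes`. [folklore] -/
theorem crystallization_of_laminarCruxes :
    LjLaminarity → LaminarSaturation → LaminarRigidity → CrysPeriodicMinAttained → _root_.Crystallization := by
  intro hLam hSat hRig hMin
  refine ⟨?_, isCrystallizing_of_laminarCruxes hLam hSat hRig⟩
  obtain ⟨P, hP⟩ := hMin
  refine ⟨P, hP, ?_⟩
  have h : (⨅ Q : Literature.MathematicalPhysics.StatisticalMechanics.PeriodicConfiguration 3,
      Q.energyPerParticle Literature.MathematicalPhysics.StatisticalMechanics.lennardJones) =
      P.energyPerParticle Literature.MathematicalPhysics.StatisticalMechanics.lennardJones :=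
    hP.csInf_eq
  have hLim := CrysEnergyLimit_holds
  unfold CrysEnergyLimit at hLim
  rw [h] at hLim
  exact hLim

end Summit.AtomisticToContinuum.Crystallization.Theorems.LaminarSixThreeThreeOfLaminarCruxes

end
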